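import Summits.ResolutionOfSingularities.KangarooAtlas.MizutaniMultiplicity
import Summits.ResolutionOfSingularities.KangarooAtlas.MizutaniLowerBound
import Literature.AlgebraicGeometry.Resolution.HironakaGroupSchemeExponent
import HarnessLib

/-!
# Mizutani's conjecture — Hironaka's `U(𝔭) ∩ L` versus Oda's `L_B`: what transfers, and the conditional reading

Cell topic `Summits/ResolutionOfSingularities/KangarooAtlas` (pub-rosobs); namespace
`Summit.ResolutionOfSingularities.KangarooAtlas.Mizutani`.  Companion of `MizutaniMultiplicity.lean`
(`hirForms k p 𝔭 e` = coefficient vectors of `U(𝔭) ∩ L_e`, Hironaka's algebra of forms of multiplicity equal to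
their degree at `𝔭`, Mizutani 1973 Def. 1.1 / §1 (c), transcribed through the symbolic power `𝔭^{(p^e)}`;
`hirForms_le_invForms : U(𝔭) ∩ L_e ⊆ (L_B)_e` for every prime).  AI-written; *AI review is weaker than expert
review*; not a resolution theorem.

* `frobVec_mem_hirForms`, `span_frobVec_image_hirForms_le` — `k·F^m(U(𝔭) ∩ L_e) ⊆ U(𝔭) ∩ L_{e+m}`;
* **`hirForms_eq_invForms_of_exponentLE`** — if `exponent(L_B) ≤ e₀` (Oda's sense) and the two spaces agree
  at level `e₀`, they agree at every level `j ≥ e₀` (both are then `k·F^{j−e₀}` of the level-`e₀` space);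
* **`hirForms_eq_invForms_of_exponentLE_zero`** — in particular for the points whose `B(𝔭)` is a VECTOR GROUP
  in Oda's sense (`ExponentLE k p 𝔭 0`), `U(𝔭) ∩ L_e = (L_B)_e` at EVERY level, unconditionally (level `0` is
  `hirForms_zero`): Oda's Prop. 2.2 (ii) holds for them in the tree;
* `mizutaniLowerBound_hirForms` — Mizutani's lower bound `m(e) ≥ 2p^e − 1` (`mizutaniLowerBound`, proved in
  this directory for Oda's `L_B`) READ THROUGH `U(𝔭) ∩ L` — exponent as in Mizutani §1 (c), dimension
  `n + 1 − dim_k (U(𝔭) ∩ L)_{e₀}` — under the displayed hypothesis that Oda's equality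
  `U(𝔭) ∩ L_e = (L_B)_e` holds at the point for all `e` (Oda 1973 Prop. 2.2 (ii), NOT proved in the tree;
  the `⊆` half is `hirForms_le_invForms`).

References: [Mizutani1973HironakaGroupSchemes] §1 (Def. 1.1, (c)), Remark 2.10;
[Oda1983HironakaGroupSchemeII] §2 (p. 1168).
-/

open MvPolynomial Literature.AlgebraicGeometry.Resolution
  Literature.AlgebraicGeometry.Resolution.HironakaScheme

namespace Summit.ResolutionOfSingularities.KangarooAtlas.Mizutani

universe u

variable {k : Type u} [Field k] {p : ℕ} [Fact p.Prime] [CharP k p] {n : ℕ}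
  {𝔭 : Ideal (MvPolynomial (Fin (n + 1)) k)} [h𝔭 : 𝔭.IsPrime]

/-- `F^m (U(𝔭) ∩ L_e) ⊆ U(𝔭) ∩ L_{e+m}`. [cite: Mizutani1973HironakaGroupSchemes, §1 (a), (c)] -/
theorem frobVec_mem_hirForms (m : ℕ) {e : ℕ} {a : Fin (n + 1) → k} (ha : a ∈ hirForms k p 𝔭 e) :
    frobVec k p m a ∈ hirForms k p 𝔭 (e + m) := by
  induction m with
  | zero =>
    have : frobVec k p 0 a = a := by funext j; simp [frobVec]
    rw [this]; exact ha
  | succ m ih =>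
    have h := frobVec_one_mem_hirForms ih
    rw [frobVec_frobVec] at h
    exact h

/-- `k·F^m(U(𝔭) ∩ L_e) ⊆ U(𝔭) ∩ L_{e+m}`. [cite: Mizutani1973HironakaGroupSchemes, §1 (a), (c)] -/
theorem span_frobVec_image_hirForms_le (m e : ℕ) :
    Submodule.span k (frobVec k p m '' (hirForms k p 𝔭 e : Set (Fin (n + 1) → k))) ≤
      hirForms k p 𝔭 (e + m) := by
  rw [Submodule.span_le]
  rintro _ ⟨a, ha, rfl⟩
  exact frobVec_mem_hirForms m ha

/-- **Transfer above the exponent**: if `exponent(L_B(𝔭)) ≤ e₀` in Oda's sense and `U(𝔭) ∩ L_{e₀} = (L_B)_{e₀}`,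
then `U(𝔭) ∩ L_j = (L_B)_j` for every `j ≥ e₀` (`(L_B)_j = k·F^{j−e₀}(L_B)_{e₀} ⊆ U(𝔭) ∩ L_j ⊆ (L_B)_j`).
[cite: Oda1983HironakaGroupSchemeII, §2 (p. 1168: exponent(Q) ≤ e iff kF^{j−e}Q_e = Q_j for all j ≥ e)] -/
theorem hirForms_eq_invForms_of_exponentLE {e₀ : ℕ} (hE : ExponentLE k p 𝔭 e₀)
    (h₀ : hirForms k p 𝔭 e₀ = invForms k p 𝔭 e₀) {j : ℕ} (hj : e₀ ≤ j) :
    hirForms k p 𝔭 j = invForms k p 𝔭 j := by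
  refine le_antisymm (hirForms_le_invForms 𝔭 j) ?_
  rw [hE j hj, ← h₀]
  obtain ⟨m, rfl⟩ := Nat.exists_eq_add_of_le hj
  rw [Nat.add_sub_cancel_left]
  exact span_frobVec_image_hirForms_le m e₀

/-- **Vector-group points**: if `B(𝔭)` is a vector group in Oda's sense (`exponent ≤ 0`), then
`U(𝔭) ∩ L_e = (L_B)_e` for every `e` — Oda's Prop. 2.2 (ii) holds for such points in the tree.
[cite: Oda1983HironakaGroupSchemeII, §2 (p. 1168); Mizutani1973HironakaGroupSchemes, Remark 1.2 (vector group iff exponent 0)] -/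
theorem hirForms_eq_invForms_of_exponentLE_zero (hE : ExponentLE k p 𝔭 0) (j : ℕ) :
    hirForms k p 𝔭 j = invForms k p 𝔭 j :=
  hirForms_eq_invForms_of_exponentLE hE (hirForms_zero 𝔭) (Nat.zero_le j)

/-- **Mizutani's lower bound read through Hironaka's `U(𝔭) ∩ L`**, CONDITIONAL on Oda's equality at the point:
if `U(𝔭) ∩ L_e = (L_B)_e` for all `e` (Oda 1973 Prop. 2.2 (ii); the `⊆` half is `hirForms_le_invForms`, the
`⊇` half is the displayed hypothesis `hOda`), then for a point `𝔭` whose `U(𝔭) ∩ L` has exponent `≤ e₀`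
(Mizutani §1 (c): `(U ∩ L)_j = k·F^{j−e₀}(U ∩ L)_{e₀}` for `j ≥ e₀`) and not `≤ e'` for any `e' < e`, one has
`2p^e ≤ (n + 1 − dim_k (U(𝔭) ∩ L)_{e₀}) + 1` — from `mizutaniLowerBound`.  Nothing new is proved about Oda's
equality here. [cite: Mizutani1973HironakaGroupSchemes, §1 (c) and Remark 2.10; Oda1983HironakaGroupSchemeII, §2 (p. 1168)] -/
theorem mizutaniLowerBound_hirForms (hOda : ∀ e, hirForms k p 𝔭 e = invForms k p 𝔭 e)
    (hP : IsPoint k 𝔭) {e e₀ : ℕ}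
    (he₀ : ∀ j, e₀ ≤ j → hirForms k p 𝔭 j =
      Submodule.span k (frobVec k p (j - e₀) '' (hirForms k p 𝔭 e₀ : Set (Fin (n + 1) → k))))
    (hlt : ∀ e', e' < e → ¬ ∀ j, e' ≤ j → hirForms k p 𝔭 j =
      Submodule.span k (frobVec k p (j - e') '' (hirForms k p 𝔭 e' : Set (Fin (n + 1) → k)))) :
    2 * p ^ e ≤ (n + 1 - Module.finrank k (hirForms k p 𝔭 e₀)) + 1 := by
  have hE : ExponentLE k p 𝔭 e₀ := by
    intro j hj
    rw [← hOda j, ← hOda e₀]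
    exact he₀ j hj
  have hlt' : ∀ e', e' < e → ¬ ExponentLE k p 𝔭 e' := by
    intro e' he' hc
    refine hlt e' he' fun j hj => ?_
    rw [hOda j, hOda e']
    exact hc j hj
  have h := mizutaniLowerBound p e k n 𝔭 e₀ hP hE hlt'
  unfold hsDimAt at h
  rw [← hOda e₀] at h
  exact h

end Summit.ResolutionOfSingularities.KangarooAtlas.Mizutani
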